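import Literature.AlgebraicGeometry.Modules.BoxTensor
import Literature.AlgebraicGeometry.Modules.StrictlyPerfectResolution
import Mathlib.Algebra.Homology.DerivedCategory.Fractions
import HarnessLib

/-!
# Road №4 (`VHCAbelianSchemesRoad`), crux stmt-HodgeConjecture-26512 `DiagLocalOfMarkmanPinnedForall` — route «2T», steps (vi)→(v):
# Ext-VANISHING FOR BOX PRODUCTS WITH COHERENT (STRICTLY-PERFECT-RESOLVED) FACTORS, FROM Ext-VANISHING OF THE FACTORS

research route conditional on HC_CM; not a corollary; Q11.4-sentence-2 already refuted in dim ≥ 3.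

Seat prover-26512-2T-i g0, item (N-1) (director-hodge g18 R18.16: GO, Theorems lane, `--supports stmt-HodgeConjecture-26512 --as helper`, 0 new facts).
In `Cruxes/DiagLocalOfMarkmanPinnedForall/PENCIL-26512-TWOTORSION.md` §2 the vanishing (vi) is a statement about SHEAVES on the curve-Jacobian factor —
`Ext•_X(I_{𝒵_C} ⊗ P_α, I_{𝒵_C}) = 0` for `α` a non-trivial two-torsion class and `C` non-hyperelliptic — and it is fed into the Künneth step (v) for a box product
whose right factor is that sheaf. The tree's Künneth input (`Modules.KunnethFormulaExt`, a displayed NAMED FACT, p681132; consequences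
`KunnethFormulaExt.abelianVariety_subsingleton_of_right ∕ _left`) is typed for BOUNDED VECTOR-BUNDLE complexes on both sides; a coherent factor enters through a
strictly perfect resolution `R : StrictlyPerfectResolution G` (`Modules/StrictlyPerfectResolution`, p-ids of typer-26512-m2: the complex `R.P`, a bounded
vector-bundle complex, with a quasi-isomorphism `R.ε : R.P ⟶ G[0]`). This file composes the two: Ext between the RESOLUTIONS is Ext between the SHEAVES
(quasi-isomorphism invariance of `Hom_{D}(Q –, (Q –)⟦n⟧)` in both arguments), so Ext-vanishing of the sheaves feeds Künneth verbatim.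

* §1 transport (any abelian category with a derived category): `subsingleton_shiftedHom_congr_of_isoQ` (isomorphisms in `D`), `…_of_quasiIso`
  (quasi-isomorphisms of complexes), `subsingleton_shiftedHom_single_single_of_neg` (`Hom_D(F₁[0], F₂[0]⟦n⟧) = 0` for `n < 0`, two objects of the heart —
  the two-object form of the venture's `DerivedCategory.subsingleton_hom_single_shift_of_neg`), and for resolutions `subsingleton_shiftedHom_resolutions_iff`
  (`Ext` computed on `R₁.P`, `R₂.P` ↔ on `G₁[0]`, `G₂[0]`), `subsingleton_shiftedHom_resolutions_of_nonneg` (only the degrees `j ≥ 0` need checking).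
* §2 **`subsingleton_shiftedHom_boxTensor_resolutions_of_right`** — on `A ×ₖ B`: bounded VB complexes `E₁, E₂` on `A`, modules `G₁, G₂` on `B` with strictly perfect
  resolutions `R₁, R₂` (ARGUMENTS — existence, Hartshorne III Ex. 6.9, is NOT assumed here), `Ext^j_B(G₁, G₂) = 0` for all `j ≥ 0` ⟹
  `Extⁿ_{A×B}(E₁ ⊠ R₁.P, E₂ ⊠ R₂.P) = 0` for all `n`, under `KunnethFormulaExt`; `…_of_left` (resolved coherent LEFT factors); `…_both` (all four resolved).

HONEST SCOPE: the right factor of print's step (v) is reached only after (M1)'s Orlov row identifies the translate of the Fourier–Mukai carrier with a box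
product of (translated-)twisted ideal sheaves; this file is the step those factors are fed into, nothing more. NOTHING here says (vi), (v), (N-U♭), (N-U), the
crux, №4, HC_AV, HC_CM or HC holds; HC_CM HELD, by name only; helper lane (width toward the crux = 0). CONDITIONAL on the named fact `KunnethFormulaExt` only.
References: [cite: StacksProject, Tag 0FXZ] [cite: GortzWedhorn2023, Cor. 22.110 (p. 286)] [cite: Markman2025SecantWeil, p. 52 (Künneth decomposition of Ext²)]
[cite: Weibel1994, §10.4 Cor. 10.4.7] [cite: Hartshorne1977, III Ex. 6.5 and Ex. 6.9] [cite: Lieblich2006, Prop. 2.1.9].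
-/

noncomputable section

open CategoryTheory CategoryTheory.Category CategoryTheory.Limits AlgebraicGeometry

universe w v u

namespace Summit.HodgeConjecture.HodgeConjecture.Ring2.SemiregularRepresentatives

set_option linter.dupNamespace false -- the cell's namespace repeats the summit name, as in every `Ring2*` file

namespace NowhereDisplaceable

open Literature.AlgebraicGeometry Literature.AlgebraicGeometry.Motives Literature.AlgebraicGeometry.Motives.AbelianVariety
open Literature.AlgebraicGeometry.Modules Literature.AlgebraicGeometry.KTheory

/-! ## §1 Transport of `Hom_D(Q K, (Q L)⟦n⟧)`-vanishing along isomorphisms of `D`, quasi-isomorphisms, and resolutions -/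

section Transport

variable {C : Type u} [Category.{v} C] [Abelian C] [HasDerivedCategory.{w} C]

/-- Transport of the vanishing of a shifted Hom set along isomorphisms IN THE DERIVED CATEGORY of both arguments. [folklore] -/
theorem subsingleton_shiftedHom_congr_of_isoQ {K K' L L' : CochainComplex C ℤ} (eK : DerivedCategory.Q.obj K ≅ DerivedCategory.Q.obj K')
    (eL : DerivedCategory.Q.obj L ≅ DerivedCategory.Q.obj L') (n : ℤ) :
    Subsingleton (ShiftedHom (DerivedCategory.Q.obj K) (DerivedCategory.Q.obj L) n) ↔
      Subsingleton (ShiftedHom (DerivedCategory.Q.obj K') (DerivedCategory.Q.obj L') n) :=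
  (eK.homCongr ((shiftFunctor (DerivedCategory C) n).mapIso eL)).subsingleton_congr

/-- **Quasi-isomorphism invariance of `Ext`-vanishing in both arguments**: quasi-isomorphisms `f : K ⟶ K'`, `g : L ⟶ L'` of cochain complexes give
`Hom_D(Q K, (Q L)⟦n⟧) = 0 ↔ Hom_D(Q K', (Q L')⟦n⟧) = 0` (`Q f`, `Q g` are isomorphisms, Mathlib `DerivedCategory.isIso_Q_map_iff_quasiIso`).
[cite: Weibel1994, §10.4 Cor. 10.4.7] -/
theorem subsingleton_shiftedHom_congr_of_quasiIso {K K' L L' : CochainComplex C ℤ} (f : K ⟶ K') (g : L ⟶ L') [QuasiIso f] [QuasiIso g] (n : ℤ) :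
    Subsingleton (ShiftedHom (DerivedCategory.Q.obj K) (DerivedCategory.Q.obj L) n) ↔
      Subsingleton (ShiftedHom (DerivedCategory.Q.obj K') (DerivedCategory.Q.obj L') n) := by
  haveI : IsIso (DerivedCategory.Q.map f) := (DerivedCategory.isIso_Q_map_iff_quasiIso _ f).2 inferInstance
  haveI : IsIso (DerivedCategory.Q.map g) := (DerivedCategory.isIso_Q_map_iff_quasiIso _ g).2 inferInstance
  exact subsingleton_shiftedHom_congr_of_isoQ (asIso (DerivedCategory.Q.map f)) (asIso (DerivedCategory.Q.map g)) n

/-- **Two objects of the heart have no negative Ext**: `Hom_D(F₁[0], F₂[0]⟦n⟧) = 0` for `n < 0` (a complex in degrees `≤ 0` maps trivially to one in degrees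
`≥ −n ≥ 1`: Mathlib `DerivedCategory.subsingleton_hom_of_isStrictlyLE_of_isStrictlyGE`; the two-object form of the venture's
`DerivedCategory.subsingleton_hom_single_shift_of_neg`). [cite: Lieblich2006, Prop. 2.1.9] [cite: Weibel1994, §10.4 Cor. 10.4.7] -/
theorem subsingleton_shiftedHom_single_single_of_neg (F₁ F₂ : C) {n : ℤ} (hn : n < 0) :
    Subsingleton (ShiftedHom (DerivedCategory.Q.obj ((CochainComplex.singleFunctor C 0).obj F₁))
      (DerivedCategory.Q.obj ((CochainComplex.singleFunctor C 0).obj F₂)) n) := by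
  haveI : (((CochainComplex.singleFunctor C 0).obj F₂)⟦n⟧).IsStrictlyGE (-n) :=
    ((CochainComplex.singleFunctor C 0).obj F₂).isStrictlyGE_shift 0 n (-n) (by omega)
  have h := DerivedCategory.subsingleton_hom_of_isStrictlyLE_of_isStrictlyGE ((CochainComplex.singleFunctor C 0).obj F₁)
    (((CochainComplex.singleFunctor C 0).obj F₂)⟦n⟧) 0 (-n) (by omega)
  exact ((Iso.refl _).homCongr ((DerivedCategory.Q.commShiftIso n).app _)).subsingleton_congr.mp h

end Transport

section Resolutions

variable {X : Scheme.{u}} {G₁ G₂ : X.Modules} (R₁ : StrictlyPerfectResolution G₁) (R₂ : StrictlyPerfectResolution G₂)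

/-- **`Ext` on strictly perfect resolutions is `Ext` of the resolved sheaves**: `Hom_D(Q R₁.P, (Q R₂.P)⟦n⟧) = 0 ↔ Hom_D(Q G₁[0], (Q G₂[0])⟦n⟧) = 0` (the augmentations
`R.ε : R.P ⟶ G[0]` are quasi-isomorphisms). [cite: Hartshorne1977, III Ex. 6.5 and Prop. 6.5] [cite: Weibel1994, §10.4 Cor. 10.4.7] -/
theorem subsingleton_shiftedHom_resolutions_iff (n : ℤ) :
    letI := HasDerivedCategory.standard X.Modules
    Subsingleton (ShiftedHom (DerivedCategory.Q.obj R₁.P) (DerivedCategory.Q.obj R₂.P) n) ↔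
      Subsingleton (ShiftedHom (DerivedCategory.Q.obj ((CochainComplex.singleFunctor X.Modules 0).obj G₁))
        (DerivedCategory.Q.obj ((CochainComplex.singleFunctor X.Modules 0).obj G₂)) n) := by
  letI := HasDerivedCategory.standard X.Modules
  haveI := R₁.quasiIso
  haveI := R₂.quasiIso
  exact subsingleton_shiftedHom_congr_of_quasiIso R₁.ε R₂.ε n

/-- **Only the degrees `j ≥ 0` matter**: if `Ext^j(G₁, G₂) = Hom_D(Q G₁[0], (Q G₂[0])⟦j⟧)` vanishes for every `j : ℕ`, then `Hom_D(Q R₁.P, (Q R₂.P)⟦n⟧) = 0` for EVERY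
`n : ℤ` (negative degrees vanish for objects of the heart). [cite: Lieblich2006, Prop. 2.1.9] [cite: Hartshorne1977, III Ex. 6.5] -/
theorem subsingleton_shiftedHom_resolutions_of_nonneg
    (hG : ∀ j : ℕ, letI := HasDerivedCategory.standard X.Modules
      Subsingleton (ShiftedHom (DerivedCategory.Q.obj ((CochainComplex.singleFunctor X.Modules 0).obj G₁))
        (DerivedCategory.Q.obj ((CochainComplex.singleFunctor X.Modules 0).obj G₂)) (j : ℤ))) (n : ℤ) :
    letI := HasDerivedCategory.standard X.Modules
    Subsingleton (ShiftedHom (DerivedCategory.Q.obj R₁.P) (DerivedCategory.Q.obj R₂.P) n) := by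
  letI := HasDerivedCategory.standard X.Modules
  rw [subsingleton_shiftedHom_resolutions_iff R₁ R₂ n]
  rcases lt_or_ge n 0 with hn | hn
  · exact subsingleton_shiftedHom_single_single_of_neg G₁ G₂ hn
  · obtain ⟨j, rfl⟩ := Int.eq_ofNat_of_zero_le hn
    exact hG j

end Resolutions

/-! ## §2 Künneth with resolved coherent factors -/

section Kunneth

variable {k : Type} [Field k] (A B : AbelianVariety k)

/-- **STEPS (vi)→(v): Ext-VANISHING FOR BOX PRODUCTS WITH COHERENT RIGHT FACTORS.** On `A ×ₖ B`, for bounded vector-bundle complexes `E₁, E₂` on `A` and modules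
`G₁, G₂` on `B` with strictly perfect resolutions `R₁, R₂`: if `Ext^j_B(G₁, G₂) = 0` for every `j ≥ 0`, then `Extⁿ_{A×B}(E₁ ⊠ R₁.P, E₂ ⊠ R₂.P) = 0` for every `n` —
CONDITIONAL on the named fact `KunnethFormulaExt` (The Stacks Project 0FXZ) and nothing else. Print: `B = Jac(C)`, `G₁ = I_{𝒵_C} ⊗ P_α`, `G₂ = I_{𝒵_C}`
(PENCIL-26512-TWOTORSION §2 (v)–(vi); Markman p. 52). [cite: StacksProject, Tag 0FXZ] [cite: Markman2025SecantWeil, p. 52 (Künneth decomposition of Ext²)] -/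
theorem subsingleton_shiftedHom_boxTensor_resolutions_of_right (h : KunnethFormulaExt) {E₁ E₂ : CochainComplex A.X.left.Modules ℤ}
    (hE₁ : IsBoundedVBComplex E₁) (hE₂ : IsBoundedVBComplex E₂) {G₁ G₂ : B.X.left.Modules} (R₁ : StrictlyPerfectResolution G₁)
    (R₂ : StrictlyPerfectResolution G₂)
    (hG : ∀ j : ℕ, letI := HasDerivedCategory.standard B.X.left.Modules
      Subsingleton (ShiftedHom (DerivedCategory.Q.obj ((CochainComplex.singleFunctor B.X.left.Modules 0).obj G₁))
        (DerivedCategory.Q.obj ((CochainComplex.singleFunctor B.X.left.Modules 0).obj G₂)) (j : ℤ))) (n : ℤ) :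
    letI := HasDerivedCategory.standard (A.prod B).X.left.Modules
    Subsingleton (ShiftedHom (DerivedCategory.Q.obj (A.boxTensorComplex B E₁ R₁.P)) (DerivedCategory.Q.obj (A.boxTensorComplex B E₂ R₂.P)) n) :=
  KunnethFormulaExt.abelianVariety_subsingleton_of_right A B h hE₁ hE₂ R₁.isBoundedVB R₂.isBoundedVB
    (fun j => subsingleton_shiftedHom_resolutions_of_nonneg R₁ R₂ hG j) n

/-- **The same with coherent LEFT factors**: resolutions `R₁, R₂` of `G₁, G₂` on `A`, bounded vector-bundle complexes `F₁, F₂` on `B`,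
`Ext^{≥0}_A(G₁, G₂) = 0 ⟹ Ext•_{A×B}(R₁.P ⊠ F₁, R₂.P ⊠ F₂) = 0`, under `KunnethFormulaExt`. [cite: StacksProject, Tag 0FXZ] -/
theorem subsingleton_shiftedHom_boxTensor_resolutions_of_left (h : KunnethFormulaExt) {G₁ G₂ : A.X.left.Modules} (R₁ : StrictlyPerfectResolution G₁)
    (R₂ : StrictlyPerfectResolution G₂) {F₁ F₂ : CochainComplex B.X.left.Modules ℤ} (hF₁ : IsBoundedVBComplex F₁) (hF₂ : IsBoundedVBComplex F₂)
    (hG : ∀ j : ℕ, letI := HasDerivedCategory.standard A.X.left.Modules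
      Subsingleton (ShiftedHom (DerivedCategory.Q.obj ((CochainComplex.singleFunctor A.X.left.Modules 0).obj G₁))
        (DerivedCategory.Q.obj ((CochainComplex.singleFunctor A.X.left.Modules 0).obj G₂)) (j : ℤ))) (n : ℤ) :
    letI := HasDerivedCategory.standard (A.prod B).X.left.Modules
    Subsingleton (ShiftedHom (DerivedCategory.Q.obj (A.boxTensorComplex B R₁.P F₁)) (DerivedCategory.Q.obj (A.boxTensorComplex B R₂.P F₂)) n) :=
  KunnethFormulaExt.abelianVariety_subsingleton_of_left A B h R₁.isBoundedVB R₂.isBoundedVB hF₁ hF₂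
    (fun j => subsingleton_shiftedHom_resolutions_of_nonneg R₁ R₂ hG j) n

/-- **All four factors resolved coherent sheaves**: `Ext^{≥0}_B(H₁, H₂) = 0 ⟹ Ext•_{A×B}(R₁.P ⊠ S₁.P, R₂.P ⊠ S₂.P) = 0` for resolutions `Rᵢ` of `Gᵢ` on `A` and
`Sᵢ` of `Hᵢ` on `B` (print's shape at a two-torsion point: left factor a translated-twisted ideal sheaf of `𝒵_Σ`, right factor the twist `I_{𝒵_C} ⊗ P_α` against
`I_{𝒵_C}`), under `KunnethFormulaExt`. [cite: StacksProject, Tag 0FXZ] [cite: Markman2025SecantWeil, p. 52 (Künneth decomposition of Ext²)] -/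
theorem subsingleton_shiftedHom_boxTensor_resolutions_both_of_right (h : KunnethFormulaExt) {G₁ G₂ : A.X.left.Modules}
    (R₁ : StrictlyPerfectResolution G₁) (R₂ : StrictlyPerfectResolution G₂) {H₁ H₂ : B.X.left.Modules} (S₁ : StrictlyPerfectResolution H₁)
    (S₂ : StrictlyPerfectResolution H₂)
    (hH : ∀ j : ℕ, letI := HasDerivedCategory.standard B.X.left.Modules
      Subsingleton (ShiftedHom (DerivedCategory.Q.obj ((CochainComplex.singleFunctor B.X.left.Modules 0).obj H₁))
        (DerivedCategory.Q.obj ((CochainComplex.singleFunctor B.X.left.Modules 0).obj H₂)) (j : ℤ))) (n : ℤ) :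
    letI := HasDerivedCategory.standard (A.prod B).X.left.Modules
    Subsingleton (ShiftedHom (DerivedCategory.Q.obj (A.boxTensorComplex B R₁.P S₁.P)) (DerivedCategory.Q.obj (A.boxTensorComplex B R₂.P S₂.P)) n) :=
  subsingleton_shiftedHom_boxTensor_resolutions_of_right A B h R₁.isBoundedVB R₂.isBoundedVB S₁ S₂ hH n

end Kunneth

end NowhereDisplaceable

end Summit.HodgeConjecture.HodgeConjecture.Ring2.SemiregularRepresentatives

end
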